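import Summits.AtomisticToContinuum.Crystallization.Theorems.PalmUnimodularRigidityShellsToBarlowChartTransportOpsDefs

/-!
# Line `develop-the-model-growth-descent` (crux `ShellsToBarlowChart`, stmt-AtomisticToContinuum-9227): pattern facts, part 14

Decidable facts (the link of a site: STAR image, LINK rows, lower-apex formulas, enumerations) about the two integer kissing patterns `fcc3Int`, `hcpInt` (labels at squared
norm `18`) used by the frame transports of `stub_transportSystem`: hexagons, even/odd caps,
their filters, apexes, distance tables, lower caps and the letters read on them.  Every fact was
first verified by brute force (work/sim/facts.py of the lead's folder) and is proved here by
`decide` (split into small files so that each elaborates quickly).  All `[folklore]`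
(finite checks on the cuboctahedron / anticuboctahedron, HalesDSP2012 §1.3).
-/

namespace Summit.AtomisticToContinuum.Crystallization.Theorems.PalmUnimodularRigidityShellsToBarlowChart

open Literature.Geometry.DiscreteGeometry Literature.MathematicalPhysics.StatisticalMechanics

/-- The twelve link offsets for letters `(-1, 1)`, enumerated. [folklore] -/
theorem linkOffsets_eq_hcp_p : linkOffsets (-1) 1 = ({(((-1) : ℤ), (0 : ℤ), (0 : ℤ)), (((-1) : ℤ), (0 : ℤ), (1 : ℤ)), (((-1) : ℤ), (1 : ℤ), (0 : ℤ)), ((0 : ℤ), ((-1) : ℤ), (0 : ℤ)), ((0 : ℤ), ((-1) : ℤ), (1 : ℤ)), ((0 : ℤ), (0 : ℤ), ((-1) : ℤ)), ((0 : ℤ), (0 : ℤ), (1 : ℤ)), ((0 : ℤ), (1 : ℤ), ((-1) : ℤ)), ((0 : ℤ), (1 : ℤ), (0 : ℤ)), ((1 : ℤ), (0 : ℤ), (0 : ℤ)), ((1 : ℤ), (0 : ℤ), (1 : ℤ)), ((1 : ℤ), (1 : ℤ), (0 : ℤ))} : Finset (ℤ × ℤ × ℤ)) := by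
  decide

/-- The twelve link offsets for letters `(1, -1)`, enumerated. [folklore] -/
theorem linkOffsets_eq_hcp_m : linkOffsets 1 (-1) = ({(((-1) : ℤ), ((-1) : ℤ), (0 : ℤ)), (((-1) : ℤ), (0 : ℤ), ((-1) : ℤ)), (((-1) : ℤ), (0 : ℤ), (0 : ℤ)), ((0 : ℤ), ((-1) : ℤ), (0 : ℤ)), ((0 : ℤ), ((-1) : ℤ), (1 : ℤ)), ((0 : ℤ), (0 : ℤ), ((-1) : ℤ)), ((0 : ℤ), (0 : ℤ), (1 : ℤ)), ((0 : ℤ), (1 : ℤ), ((-1) : ℤ)), ((0 : ℤ), (1 : ℤ), (0 : ℤ)), ((1 : ℤ), ((-1) : ℤ), (0 : ℤ)), ((1 : ℤ), (0 : ℤ), ((-1) : ℤ)), ((1 : ℤ), (0 : ℤ), (0 : ℤ))} : Finset (ℤ × ℤ × ℤ)) := by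
  decide

end Summit.AtomisticToContinuum.Crystallization.Theorems.PalmUnimodularRigidityShellsToBarlowChart
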